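import Literature.NumberTheory.EllipticCurves.Kobayashi2003.FineSelmerLeSignedSelmerProofs
import Literature.NumberTheory.GaloisRepresentations.ContinuousH1OrderTwo
import Summits.BirchSwinnertonDyer.Rank1Residual.Additive.ClassicalConditionAwayBadPlaces
import HarnessLib

/-!
# Route `ThetaPartnerAtTwo` (TP2), crux K3 `SignedKatoDivisibilityUpToAtTwo` (item stmt-BirchSwinnertonDyer-20308),
# line `colemanrat` v3 — THE FINE SANDWICH: `2 · (Sel^ε(E/K_∞) ∩ Str_p) ≤ Sel₀(K_∞, E[p^∞]) ≤ Sel^ε(E/K_∞) ∩ Str_p`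
# (`Str_p` = locally trivial at every place above `p`), any number field `K`, prime `p`, `ℤ_p`-extension `κ`, sign `ε`;
# `Sel₀ = Sel^ε ∩ Str_p` on the nose for odd `p`. Hence the kernel of the restriction `X^ε ↠ X₀` (file
# `…FineRestriction`) is controlled, UP TO THE FACTOR `2`, by the image of `Sel^ε` in the local cohomology at `p`
# — the «cover up to `2^m`» input of the four-term road (`SignedKatoOffTwo.fourTerm_lengthAt_le_upTo`).

Width seat `bsd-wall-tp2-p2x-w3` g2 (cell `bsd-wall`). HONEST FRAMING: THEOREMS ONLY — no definition, no named fact, no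
instance, no `sorry`; route-independent (no `Theses` import); closes no item; BSD is NOT proved by any of this.

## Why this file

The (PT) clause of K3's `2`-robust package asks, for the `Λ`-linear restriction `k : X^ε ↠ X₀` dual to
`Sel₀ ≤ Sel^ε` (tree: `Kobayashi2003.fineSelmerInfty_le_signedSelmerInfty`; `k` on the pinned duals: `…FineRestriction`),
that `ker k` be covered — up to `2^m` — by the local module at `p`. `ker k` is the Pontryagin dual of `Sel^ε/Sel₀`; the
local module sees `Sel^ε/(Sel^ε ∩ Str_p)`. The two differ by `(Sel^ε ∩ Str_p)/Sel₀`, and THIS FILE shows that group is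
KILLED BY `2` (and is `0` for odd `p`): a class of `Sel^ε(E/K_∞)` (Kobayashi Def. 1.1: classical Kummer conditions at every
place, signed Kummer condition above `p`) that is locally trivial above `p` satisfies
* the fine condition at every finite `v ∤ p` — the classical condition over `K_∞` at `v ∤ p` IS «locally trivial»
  (Greenberg's `Im κ_η = 0`, LNM 1716 Prop. 2.1; tree: `Rank1Residual.Additive.localKerOver_le_awayKer`, any reduction type);
* the fine condition at every infinite place AFTER MULTIPLICATION BY `2` — `2 · H¹(K_{∞,w}, ·) = 0` since `Gal(ℂ/K_w)` has order
  `≤ 2` (Serre I §2.4; tree: `two_nsmul_continuousCohomology_one_eq_zero_of_natCard_le_two`). At `p = 2` this factor is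
  genuinely needed (real places, `H¹(ℝ, E[2^∞]) ≠ 0` when `Δ_E > 0`) and is exactly one of the `2`-power defects the robust road
  absorbs (lead memo G2-PORT-AT-2 §4: «terms at the real places are 2-torsion ⇒ m = 1 suffices»).

## What is proved (`M = E[p^∞] = W.geomPrimaryTorsion p`, `H = Gal(K̄/K_∞) = κ.kerSubgroup`, `Str_p(s)` = «`conj_σ s` lies in the
## strict kernel of the fine datum at every `v ∣ p` and every `σ`»)

* §1 `two_nsmul_mem_infKer` — `2 • c ∈ infKer H M w` for EVERY class `c ∈ H¹(H, M)`, every `H ≤ Γ_K`, every infinite `w`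
  (any discrete `Γ_K`-module `M`); `mem_infKer_of_odd_nsmul_eq_zero` (odd-torsion classes lie in `infKer`).
* §2 `two_nsmul_mem_fineSelmerInfty_of_mem_signedSelmerInfty` — **`s ∈ Sel^ε(E/K_∞)`, `Str_p(s)` ⇒ `2 • s ∈ Sel₀(K_∞, E[p^∞])`**;
  `mem_fineSelmerInfty_of_mem_signedSelmerInfty_of_odd` — for odd `p`, `s` itself; `strict_of_mem_fineSelmerInfty` — the
  converse direction `Sel₀ ⇒ Str_p` (definitional), so `Sel₀ = Sel^ε ∩ Str_p` for odd `p` (`mem_fineSelmerInfty_iff_of_odd`).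
* §3 consequences for characters (the currency of the pinned duals `SignedSelmerDualData.toDual`):
  `apply_two_nsmul_eq_zero_of_vanishesOnFine` — a character of `Sel^ε` vanishing on `Sel₀` kills `2 • s` for every `s` with
  `Str_p(s)`; `toDual_two_nsmul_apply_eq_zero` — for a pinned `D : SignedSelmerDualData W κ γ ε` and `x` with `D.toDual x`
  vanishing on `Sel₀` (= `x ∈ ker k` of `…FineRestriction`), `D.toDual (2 • x)` vanishes on `Sel^ε ∩ Str_p`.

References: [Kobayashi2003] Def. 1.1 (p. 2), (7.17)–(7.21) (pp. 12–13); [GreenbergLNM1716] §2 Prop. 2.1 (p. 72), §3 p. 85;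
[Greenberg1989] §1 p. 98 (the strict Selmer group); [SerreGaloisCohomology1997] I §2.4 (Cor. of Prop. 9); [CoatesSujatha2005] §3.
-/

set_option autoImplicit false
-- the Theorems namespace of this sub repeats the summit name by design (D-0017 nested layout)
set_option linter.dupNamespace false

noncomputable section

open scoped Classical

namespace Summit.BirchSwinnertonDyer.BirchSwinnertonDyer.Theorems

namespace SignedKatoOffTwo.FineSandwich

open WeierstrassCurve NumberField IsDedekindDomain Field Literature.NumberTheory.EllipticCurves
  Literature.NumberTheory.EllipticCurves.Kobayashi2003 Literature.NumberTheory.EllipticCurves.GreenbergSelmer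
  Literature.NumberTheory.GaloisRepresentations ZpExtension
  Summit.BirchSwinnertonDyer.Rank1Residual.Additive

universe u

/-! ## §1 Archimedean places: `2 · H¹(K_{∞,w}, M) = 0` -/

section Archimedean

variable {K : Type u} [Field K] (H : Subgroup (absoluteGaloisGroup K))
  (M : Type u) [AddCommGroup M] [DistribMulAction (absoluteGaloisGroup K) M] [TopologicalSpace M]
  [DiscreteTopology M]

/-- `H ⊓ D_w` is finite of order `≤ 2` for an infinite place `w` (it embeds in the image of `Γ_{K_w} = Gal(ℂ/K_w)`).
[cite: SerreGaloisCohomology1997, I §2.4] -/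
theorem finite_and_natCard_inf_decompInf_le_two (w : InfinitePlace K) :
    Finite (H ⊓ decompInf w : Subgroup (absoluteGaloisGroup K)) ∧
      Nat.card (H ⊓ decompInf w : Subgroup (absoluteGaloisGroup K)) ≤ 2 := by
  haveI := finite_absoluteGaloisGroup_completion_infinitePlace w
  have hsurj : ∀ g : (H ⊓ decompInf w : Subgroup (absoluteGaloisGroup K)),
      ∃ τ : absoluteGaloisGroup w.Completion, absGaloisRestrict K w.Completion τ = g := fun g ↦
    (Subgroup.mem_inf.mp g.2).2
  choose lift hlift using hsurj
  have hinj : Function.Injective lift := fun g g' h ↦ by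
    apply Subtype.ext
    rw [← hlift g, ← hlift g', h]
  haveI : Finite (H ⊓ decompInf w : Subgroup (absoluteGaloisGroup K)) := Finite.of_injective lift hinj
  exact ⟨this, (Nat.card_le_card_of_injective lift hinj).trans
    (natCard_absoluteGaloisGroup_completion_infinitePlace_le_two w)⟩

/-- **`2 • c` is locally trivial at every infinite place**, for EVERY class `c ∈ H¹(H, M)`: its restriction to `H ⊓ D_w`
is a class of a group of order `≤ 2`, killed by `2` (`two_nsmul_continuousCohomology_one_eq_zero_of_natCard_le_two`).
[cite: SerreGaloisCohomology1997, I §2.4 (Cor. of Prop. 9)] [cite: Greenberg1989, §1 p. 98 (3)] -/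
theorem two_nsmul_mem_infKer (w : InfinitePlace K) (c : subgroupH1 H M) : 2 • c ∈ infKer H M w := by
  obtain ⟨hfin, hcard⟩ := finite_and_natCard_inf_decompInf_le_two H w
  haveI := hfin
  rw [infKer, AddMonoidHom.mem_ker, map_nsmul]
  exact two_nsmul_continuousCohomology_one_eq_zero_of_natCard_le_two hcard _ _

/-- A class killed by an ODD integer is locally trivial at every infinite place (it is killed by `2` there too).
[cite: SerreGaloisCohomology1997, I §2.4 (Cor. of Prop. 9)] -/
theorem mem_infKer_of_odd_nsmul_eq_zero (w : InfinitePlace K) {n : ℕ} (hn : Odd n) (c : subgroupH1 H M)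
    (hc : n • c = 0) : c ∈ infKer H M w := by
  obtain ⟨hfin, hcard⟩ := finite_and_natCard_inf_decompInf_le_two H w
  haveI := hfin
  rw [infKer, AddMonoidHom.mem_ker]
  exact eq_zero_of_odd_nsmul_eq_zero_of_natCard_le_two hcard _ hn _ (by rw [← map_nsmul, hc, map_zero])

end Archimedean

/-! ## §2 The sandwich `2 · (Sel^ε ∩ Str_p) ≤ Sel₀ ≤ Sel^ε ∩ Str_p` -/

section Sandwich

variable {K : Type u} [Field K] [NumberField K] (W : WeierstrassCurve K) [W.IsElliptic] {p : ℕ} [Fact p.Prime]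
  (κ : ZpExtension K p) (ε : ℤˣ)

/-- **`2 · (Sel^ε(E/K_∞) ∩ Str_p) ≤ Sel₀(K_∞, E[p^∞])`.** A class of Kobayashi's signed Selmer group over `K_∞` which is
locally trivial at every place above `p` has its DOUBLE in the fine Selmer group: away from `p` the classical condition over
`K_∞` is local triviality (`localKerOver_le_awayKer`, Greenberg's `Im κ_η = 0`), at the infinite places `2 · H¹ = 0`.
[cite: Kobayashi2003, Def. 1.1 (p. 2)] [cite: GreenbergLNM1716, §2 Prop. 2.1 (p. 72)] [cite: Greenberg1989, §1 p. 98] -/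
theorem two_nsmul_mem_fineSelmerInfty_of_mem_signedSelmerInfty {s : W.subgroupH1 p κ.kerSubgroup}
    (hs : s ∈ signedSelmerInfty W κ ε)
    (hstr : ∀ (v : HeightOneSpectrum (𝓞 K)) (hv : ((p : ℕ) : 𝓞 K) ∈ v.asIdeal) (σ : absoluteGaloisGroup K),
      conjH1 κ.kerSubgroup (W.geomPrimaryTorsion p) σ s ∈
        (fineData (W.geomPrimaryTorsion p) p v hv).strictKer κ.kerSubgroup) :
    2 • s ∈ W.fineSelmerInfty κ := by
  have hsel := (W.mem_selmerGroupOver_iff p κ.kerSubgroup s).1 (signedSelmerInfty_le_selmerInfty W κ ε hs)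
  show 2 • s ∈ strictSelmerGroupOver κ.kerSubgroup (W.geomPrimaryTorsion p) p (fineData (W.geomPrimaryTorsion p) p)
  rw [mem_strictSelmerGroupOver_iff]
  refine ⟨fun v hv σ ↦ ?_, fun w σ ↦ ?_, fun v hv σ ↦ ?_⟩
  · rw [map_nsmul]
    exact AddSubgroup.nsmul_mem _ (localKerOver_le_awayKer (κ := κ) (v := v) (W := W) (p := p) hv (hsel.1 v σ)) 2
  · rw [map_nsmul]
    exact two_nsmul_mem_infKer κ.kerSubgroup (W.geomPrimaryTorsion p) w _
  · rw [map_nsmul]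
    exact AddSubgroup.nsmul_mem _ (hstr v hv σ) 2

/-- **For odd `p`: `Sel^ε(E/K_∞) ∩ Str_p ≤ Sel₀(K_∞, E[p^∞])`** — `s` is `p`-primary (`p^k s = 0`, `p^k` odd) and
`2 • s ∈ Sel₀`, so `s = p^k s − ((p^k − 1)/2) · (2 • s) ∈ Sel₀`. [cite: Kobayashi2003, Def. 1.1 (p. 2), (7.17) (p. 12)]
[cite: CoatesSujatha2005, §3] -/
theorem mem_fineSelmerInfty_of_mem_signedSelmerInfty_of_odd (hp : Odd p) {s : W.subgroupH1 p κ.kerSubgroup}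
    (hs : s ∈ signedSelmerInfty W κ ε)
    (hstr : ∀ (v : HeightOneSpectrum (𝓞 K)) (hv : ((p : ℕ) : 𝓞 K) ∈ v.asIdeal) (σ : absoluteGaloisGroup K),
      conjH1 κ.kerSubgroup (W.geomPrimaryTorsion p) σ s ∈
        (fineData (W.geomPrimaryTorsion p) p v hv).strictKer κ.kerSubgroup) :
    s ∈ W.fineSelmerInfty κ := by
  have h2 := two_nsmul_mem_fineSelmerInfty_of_mem_signedSelmerInfty W κ ε hs hstr
  obtain ⟨k, hk⟩ := W.exists_pow_smul_subgroupH1_ker_eq_zero κ s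
  obtain ⟨m, hm⟩ : ∃ m, p ^ k = 2 * m + 1 := hp.pow
  have hs' : s = -(m • (2 • s)) := by
    have e : (2 * m + 1) • s = 0 := by rw [← hm]; exact hk
    rw [add_nsmul, one_nsmul, mul_nsmul] at e
    exact eq_neg_of_add_eq_zero_right e
  rw [hs']
  exact neg_mem (AddSubgroup.nsmul_mem _ h2 m)

omit [W.IsElliptic] in
/-- **The converse inclusion `Sel₀ ≤ Sel^ε ∩ Str_p`** (the strict condition above `p` is part of the definition of the fine
Selmer group; `Sel₀ ≤ Sel^ε` is the tree's `fineSelmerInfty_le_signedSelmerInfty`). [cite: Greenberg1989, §1 p. 98]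
[cite: CoatesSujatha2005, §3] -/
theorem strict_of_mem_fineSelmerInfty {s : W.subgroupH1 p κ.kerSubgroup} (hs : s ∈ W.fineSelmerInfty κ)
    (v : HeightOneSpectrum (𝓞 K)) (hv : ((p : ℕ) : 𝓞 K) ∈ v.asIdeal) (σ : absoluteGaloisGroup K) :
    conjH1 κ.kerSubgroup (W.geomPrimaryTorsion p) σ s ∈
      (fineData (W.geomPrimaryTorsion p) p v hv).strictKer κ.kerSubgroup :=
  ((mem_strictSelmerGroupOver_iff (H := κ.kerSubgroup) (M := W.geomPrimaryTorsion p)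
    (L := fineData (W.geomPrimaryTorsion p) p) s).1 hs).2.2 v hv σ

/-- **`Sel₀ = Sel^ε ∩ Str_p` for odd `p`**, as a membership criterion. [cite: Kobayashi2003, Def. 1.1 (p. 2), (7.17) (p. 12)]
[cite: Greenberg1989, §1 p. 98] -/
theorem mem_fineSelmerInfty_iff_of_odd (hp : Odd p) (s : W.subgroupH1 p κ.kerSubgroup) :
    s ∈ W.fineSelmerInfty κ ↔ s ∈ signedSelmerInfty W κ ε ∧
      ∀ (v : HeightOneSpectrum (𝓞 K)) (hv : ((p : ℕ) : 𝓞 K) ∈ v.asIdeal) (σ : absoluteGaloisGroup K),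
        conjH1 κ.kerSubgroup (W.geomPrimaryTorsion p) σ s ∈
          (fineData (W.geomPrimaryTorsion p) p v hv).strictKer κ.kerSubgroup :=
  ⟨fun hs ↦ ⟨fineSelmerInfty_le_signedSelmerInfty W κ ε hs, strict_of_mem_fineSelmerInfty W κ hs⟩,
    fun h ↦ mem_fineSelmerInfty_of_mem_signedSelmerInfty_of_odd W κ ε hp h.1 h.2⟩

/-! ## §3 Consequences for characters (the currency of the pinned duals) -/

/-- **A character of `Sel^ε(E/K_∞)` vanishing on `Sel₀` kills `2 • s` for every `s ∈ Sel^ε ∩ Str_p`** (any `p`; at odd `p` it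
kills `s`). This is the statement «`ker(X^ε → X₀)` is a quotient of the dual of `Sel^ε/(Sel^ε ∩ Str_p)`, up to the factor `2`».
[cite: Kobayashi2003, (7.17)–(7.21) (pp. 12–13)] -/
theorem apply_two_nsmul_eq_zero_of_vanishesOnFine {A : Type*} [AddCommGroup A]
    (χ : signedSelmerInfty W κ ε →+ A)
    (hχ : ∀ t : W.fineSelmerInfty κ, χ (AddSubgroup.inclusion (fineSelmerInfty_le_signedSelmerInfty W κ ε) t) = 0)
    (s : signedSelmerInfty W κ ε)
    (hstr : ∀ (v : HeightOneSpectrum (𝓞 K)) (hv : ((p : ℕ) : 𝓞 K) ∈ v.asIdeal) (σ : absoluteGaloisGroup K),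
      conjH1 κ.kerSubgroup (W.geomPrimaryTorsion p) σ (s : W.subgroupH1 p κ.kerSubgroup) ∈
        (fineData (W.geomPrimaryTorsion p) p v hv).strictKer κ.kerSubgroup) :
    χ (2 • s) = 0 := by
  have h2 := two_nsmul_mem_fineSelmerInfty_of_mem_signedSelmerInfty W κ ε s.2 hstr
  have e : (2 • s : signedSelmerInfty W κ ε) =
      AddSubgroup.inclusion (fineSelmerInfty_le_signedSelmerInfty W κ ε)
        ⟨2 • (s : W.subgroupH1 p κ.kerSubgroup), h2⟩ := Subtype.ext rfl
  rw [e]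
  exact hχ _

/-- Odd `p`: a character of `Sel^ε` vanishing on `Sel₀` kills every `s ∈ Sel^ε ∩ Str_p`. [cite: Kobayashi2003, (7.17)–(7.21) (pp. 12–13)] -/
theorem apply_eq_zero_of_vanishesOnFine_of_odd (hp : Odd p) {A : Type*} [AddCommGroup A]
    (χ : signedSelmerInfty W κ ε →+ A)
    (hχ : ∀ t : W.fineSelmerInfty κ, χ (AddSubgroup.inclusion (fineSelmerInfty_le_signedSelmerInfty W κ ε) t) = 0)
    (s : signedSelmerInfty W κ ε)
    (hstr : ∀ (v : HeightOneSpectrum (𝓞 K)) (hv : ((p : ℕ) : 𝓞 K) ∈ v.asIdeal) (σ : absoluteGaloisGroup K),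
      conjH1 κ.kerSubgroup (W.geomPrimaryTorsion p) σ (s : W.subgroupH1 p κ.kerSubgroup) ∈
        (fineData (W.geomPrimaryTorsion p) p v hv).strictKer κ.kerSubgroup) :
    χ s = 0 := by
  have h1 := mem_fineSelmerInfty_of_mem_signedSelmerInfty_of_odd W κ ε hp s.2 hstr
  have e : s = AddSubgroup.inclusion (fineSelmerInfty_le_signedSelmerInfty W κ ε)
      ⟨(s : W.subgroupH1 p κ.kerSubgroup), h1⟩ := Subtype.ext rfl
  rw [e]
  exact hχ _

/-- **On the pinned dual** `D : SignedSelmerDualData W κ γ ε`: if `D.toDual x` vanishes on `Sel₀` (i.e. `x ∈ ker (X^ε → X₀)`, file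
`…FineRestriction.fineRestrict_eq_zero_iff`), then `D.toDual (2 • x)` vanishes on `Sel^ε ∩ Str_p` — so `2 • x` is a character of
`Sel^ε/(Sel^ε ∩ Str_p) ↪ ⊕_{w ∣ p} H¹(K_{∞,w}, E[p^∞])`: the «cover up to `2`» shape of the four-term road.
[cite: Kobayashi2003, (7.17)–(7.21) (pp. 12–13)] -/
theorem toDual_two_nsmul_apply_eq_zero {γ : absoluteGaloisGroup K} (D : SignedSelmerDualData W κ γ ε) (x : D.X)
    (hx : ∀ t : W.fineSelmerInfty κ,
      D.toDual x (AddSubgroup.inclusion (fineSelmerInfty_le_signedSelmerInfty W κ ε) t) = 0)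
    (s : signedSelmerInfty W κ ε)
    (hstr : ∀ (v : HeightOneSpectrum (𝓞 K)) (hv : ((p : ℕ) : 𝓞 K) ∈ v.asIdeal) (σ : absoluteGaloisGroup K),
      conjH1 κ.kerSubgroup (W.geomPrimaryTorsion p) σ (s : W.subgroupH1 p κ.kerSubgroup) ∈
        (fineData (W.geomPrimaryTorsion p) p v hv).strictKer κ.kerSubgroup) :
    D.toDual (2 • x) s = 0 := by
  rw [map_nsmul, AddMonoidHom.nsmul_apply, ← map_nsmul]
  exact apply_two_nsmul_eq_zero_of_vanishesOnFine W κ ε (D.toDual x) hx s hstr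

/-- Odd `p`, pinned dual: `D.toDual x` vanishing on `Sel₀` vanishes on `Sel^ε ∩ Str_p`. [cite: Kobayashi2003, (7.17)–(7.21) (pp. 12–13)] -/
theorem toDual_apply_eq_zero_of_odd (hp : Odd p) {γ : absoluteGaloisGroup K} (D : SignedSelmerDualData W κ γ ε)
    (x : D.X)
    (hx : ∀ t : W.fineSelmerInfty κ,
      D.toDual x (AddSubgroup.inclusion (fineSelmerInfty_le_signedSelmerInfty W κ ε) t) = 0)
    (s : signedSelmerInfty W κ ε)
    (hstr : ∀ (v : HeightOneSpectrum (𝓞 K)) (hv : ((p : ℕ) : 𝓞 K) ∈ v.asIdeal) (σ : absoluteGaloisGroup K),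
      conjH1 κ.kerSubgroup (W.geomPrimaryTorsion p) σ (s : W.subgroupH1 p κ.kerSubgroup) ∈
        (fineData (W.geomPrimaryTorsion p) p v hv).strictKer κ.kerSubgroup) :
    D.toDual x s = 0 :=
  apply_eq_zero_of_vanishesOnFine_of_odd W κ ε hp (D.toDual x) hx s hstr

end Sandwich

end SignedKatoOffTwo.FineSandwich

end Summit.BirchSwinnertonDyer.BirchSwinnertonDyer.Theorems

end
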